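import Summits.BirchSwinnertonDyer.BirchSwinnertonDyer.Theorems.PrintCFramBottomClassIndexLawFiveLeHalfIntegralBridge
import Literature.NumberTheory.EllipticCurves.ModularSymbolsHeckeProofs
import HarnessLib

set_option autoImplicit false

/-!
# Crux `PrintCFram.BottomClassIndexLawFiveLe` (stmt-BirchSwinnertonDyer-20372), line `eisenstein-resource-bdp-line` (registry v27):
# the typing of `stub_flipRung`, piece (G) — THE VEHICLE'S INVARIANCE `hinv` under `Γ₀(Mq²) ⊓ Γ₁(M)`
# (cell `bsd-print-cfram`, width seat `bsd-line-cfram-p1-w4` g19; THEOREMS ONLY, `--supports` 20372; BSD is not proved by any of this)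

HONEST FRAMING. Pure bookkeeping about functions on `ℍ` and slash operators; nothing here is a statement about elliptic curves,
Bernoulli numbers or BSD; no registered stub is closed. T3 (`…FlipRungSlash`, `…FlipRungSlashCoeff`) reads the twisted vehicle at
the flipped cusp from ONE structural input, the hypothesis
`hinv : ∀ γ : SL₂(ℤ), M·q² ∣ γ₁₀ → M ∣ γ₁₁ − 1 → F₀ ∣_k γ = F₀` (invariance under `Γ₀(Mq²) ⊓ Γ₁(M)`, not just `Γ₁(Mq²)`).
This file supplies it for the vehicle of T5 (w8 g9): `F₀ =` the away-from-`q` cut, i.e. a TRANSLATE AVERAGE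
`z ↦ Σ_{j mod Q₀} b(j)·F(z + j/Q₀)`, of the base `F = H_k · θ((qQ₀)²·) ∈ M_{(2k+2)/2}(4q²Q₀², 1)` (w8 g7's half-integral currency):

* §1 (G1) **`slash_eq_of_mem_even_of_chi_eq_one`**: for `F ∈ halfIntModularForms (2κ) N χ`, `4 ∣ N`, and `γ ∈ SL₂(ℤ)` with
  `N ∣ γ₁₀`, `χ(γ₁₁) = 1`, `4 ∣ γ₁₁ − 1`: `F ∣_κ γ = F` (w8 g7's `apply_smul_eq_of_mem_even` — the sign `χ₋₄(d)^κ` and the character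
  die); `slash_eq_of_mem_even_one` the `χ = 1` case (`{N ∣ c, 4 ∣ d − 1}`-invariance).
* §2 (G2) **`translateAverage_slash_eq`**: if `F ∣_κ γ′ = F` for every `γ′` with `L ∣ γ′₁₀`, `L₁ ∣ γ′₁₁ − 1` (`L₁ ∣ L`), then the translate
  average `T(z) = Σ_{j mod N₀} b(j) F(z + j/N₀)` (ANY weights `b`) satisfies `T ∣_κ γ = T` for every `γ` with `L N₀² ∣ γ₁₀`, `N₀ ∣ γ₁₁ − 1`,
  `L₁ ∣ γ₁₁ − 1`: each translate conjugates `γ` into `γ′_j = τ(j/N₀) γ τ(−j/N₀) ∈ SL₂(ℤ)` (`N₀ ∣ a − d` makes it integral) with the same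
  lower-left entry and `d′ ≡ d (mod L N₀)`. NO square-class condition on the weights (that is the point of T3's `D ≡ q² (mod M)`).
* §3 (G3) **`vehicle_slash_eq`**: the T3 shape — for `F ∈ halfIntModularForms (2κ) (4·(q·Q₀)²) 1` and weights `b : ℤ/Q₀ → ℂ`, the
  translate average is invariant under every `γ` with `(4Q₀⁴)·q² ∣ γ₁₀` and `4Q₀⁴ ∣ γ₁₁ − 1` (`M = 4Q₀⁴`, `q ∤ M` when `q ∤ 2Q₀`).
The `ModularForm` avatars, q-expansions and the twist `V` at `q` are T4 file 3 (w3 g19) / T5 layer B (w8 g9). beyond-print theorem: NO.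

References: [Shimura1971] Prop. 3.64; [Shimura1973HalfIntegral] §1; [DiamondShurman2005] §1.2; crux notes lead-g14 §2.5.
-/

-- summit-side namespace `Summit.BirchSwinnertonDyer.BirchSwinnertonDyer.…` (single-conjunct summit, D-0017 layout)
set_option linter.dupNamespace false

noncomputable section

open scoped MatrixGroups ModularForm Real Classical
open UpperHalfPlane hiding I
open Complex Matrix.GeneralLinearGroup CongruenceSubgroup Function
open Literature.NumberTheory.EllipticCurves.ModularForms

namespace Summit.BirchSwinnertonDyer.BirchSwinnertonDyer.Theorems.PrintCFram.FlipRung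

open Summit.BirchSwinnertonDyer.BirchSwinnertonDyer.Theorems.PrintCFram.HalfIntegralBridge

/-! ## §1 (G1) Base invariance: even theta-index, trivial character value, `d ≡ 1 (mod 4)` -/

/-- **(G1) `F ∣_κ γ = F` on `{N ∣ c, χ(d) = 1, d ≡ 1 (mod 4)}` for `F ∈ M_{2κ/2}(N, χ)`, `4 ∣ N`.** By Shimura 1973 §1
(`M_{2κ/2}(N, χ) = M_κ(Γ₀(N), χχ₋₄^κ)`, w8 g7's `apply_smul_eq_of_mem_even`) the automorphy factor is `χ(d)·χ₋₄(d)^κ·(cz+d)^κ`; both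
prefactors are `1` here. [cite: Shimura1973HalfIntegral, §1] -/
theorem slash_eq_of_mem_even_of_chi_eq_one {N : ℕ} (hN : 4 ∣ N) {κ : ℕ} {χ : DirichletCharacter ℂ N} {F : ℍ → ℂ}
    (hF : F ∈ halfIntModularForms (2 * κ) N χ) (γ : SL(2, ℤ)) (hc : (N : ℤ) ∣ γ 1 0)
    (hχ : χ ((γ 1 1 : ℤ) : ZMod N) = 1) (hd : (4 : ℤ) ∣ γ 1 1 - 1) : F ∣[(κ : ℤ)] γ = F := by
  have hγ : γ ∈ Gamma0 N := by
    rw [Gamma0_mem, ZMod.intCast_zmod_eq_zero_iff_dvd]; exact hc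
  have hd' : (γ 1 1 : ℤ) % 4 = 1 := by omega
  funext z
  rw [ModularForm.slash_action_eq'_iff, apply_smul_eq_of_mem_even hN hF hγ z, hχ, hd', zpow_natCast]
  norm_num

/-- **`F ∣_κ γ = F` on `{N ∣ c, d ≡ 1 (mod 4)}` for `F ∈ M_{2κ/2}(N, 1)` (trivial character), `4 ∣ N`** — the case of the vehicle's base
`H_k · θ(Q²·) ∈ M_{(2k+2)/2}(4Q², 1)`. (`d` is prime to `c`, hence to `N`, so `1(d) = 1`.) [cite: Shimura1973HalfIntegral, §1] -/
theorem slash_eq_of_mem_even_one {N : ℕ} [NeZero N] (hN : 4 ∣ N) {κ : ℕ} {F : ℍ → ℂ}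
    (hF : F ∈ halfIntModularForms (2 * κ) N (1 : DirichletCharacter ℂ N)) (γ : SL(2, ℤ)) (hc : (N : ℤ) ∣ γ 1 0)
    (hd : (4 : ℤ) ∣ γ 1 1 - 1) : F ∣[(κ : ℤ)] γ = F := by
  refine slash_eq_of_mem_even_of_chi_eq_one hN hF γ hc ?_ hd
  have hunit : IsUnit (((γ 1 1 : ℤ) : ZMod N)) := by
    rw [ZMod.coe_int_isUnit_iff_isCoprime]
    have hg : IsCoprime (γ 1 0 : ℤ) (γ 1 1 : ℤ) := by
      rw [Int.isCoprime_iff_gcd_eq_one]; exact gcd_c_d_eq_one γ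
    exact hg.of_isCoprime_of_dvd_left hc
  exact MulChar.one_apply hunit

/-! ## §2 (G2) Invariance is inherited by translate averages (no condition on the weights) -/

/-- **The conjugate of `γ` by the translation `τ(j/N₀)` read on `ℍ`.** For `γ = [a b; c d] ∈ SL₂(ℤ)` with `c = L N₀² c₁`,
`d − 1 = N₀ e`, and the integers `t := e + a e − b L N₀ c₁` (`d − a = N₀ t`), the matrix
`γ′ = [a + j L N₀ c₁, b + j t − j² L c₁; L N₀² c₁, d − j L N₀ c₁]` lies in `SL₂(ℤ)` and for `γ′` given by these entries:
`γ′ • (j/N₀ + z) = j/N₀ + γ • z` and `c·(j/N₀ + z) + d′ = c z + d`. [cite: Shimura1971, Prop. 3.64] -/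
theorem conj_translate_smul_eq (γ γ' : SL(2, ℤ)) {L N₀ c₁ e : ℤ} (hN₀ : N₀ ≠ 0) (j : ℤ)
    (hc : γ 1 0 = L * N₀ ^ 2 * c₁) (he : γ 1 1 - 1 = N₀ * e)
    (h00 : γ' 0 0 = γ 0 0 + j * L * N₀ * c₁)
    (h01 : γ' 0 1 = γ 0 1 + j * (e + γ 0 0 * e - γ 0 1 * L * N₀ * c₁) - j ^ 2 * L * c₁)
    (h10 : γ' 1 0 = L * N₀ ^ 2 * c₁) (h11 : γ' 1 1 = γ 1 1 - j * L * N₀ * c₁) (z : ℍ) :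
    γ' • (((j : ℝ) / N₀) +ᵥ z) = ((j : ℝ) / N₀) +ᵥ (γ • z) ∧
      ((γ' 1 0 : ℤ) : ℂ) * ((((j : ℝ) / N₀) +ᵥ z : ℍ) : ℂ) + ((γ' 1 1 : ℤ) : ℂ) =
        ((γ 1 0 : ℤ) : ℂ) * (z : ℂ) + ((γ 1 1 : ℤ) : ℂ) := by
  have hdet : γ 0 0 * γ 1 1 - γ 0 1 * γ 1 0 = 1 := by
    have := Matrix.det_fin_two (γ : Matrix (Fin 2) (Fin 2) ℤ)
    rw [Matrix.SpecialLinearGroup.det_coe] at this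
    linear_combination -this
  have hN₀C : (N₀ : ℂ) ≠ 0 := by exact_mod_cast hN₀
  have hdenz : ((γ 1 0 : ℤ) : ℂ) * (z : ℂ) + ((γ 1 1 : ℤ) : ℂ) ≠ 0 := by
    have h := denom_ne_zero γ z
    rwa [ModularGroup.denom_apply] at h
  have hpt : ((((j : ℝ) / N₀) +ᵥ z : ℍ) : ℂ) = (j : ℂ) / N₀ + z := by
    rw [coe_vadd]; push_cast; ring
  -- `d − a = N₀ · t`
  have ht : (γ 1 1 : ℤ) - γ 0 0 = N₀ * (e + γ 0 0 * e - γ 0 1 * L * N₀ * c₁) := by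
    rw [hc] at hdet
    linear_combination (1 + γ 0 0) * he - hdet
  have hcC : ((γ 1 0 : ℤ) : ℂ) = L * N₀ ^ 2 * c₁ := by exact_mod_cast hc
  have htC : ((γ 1 1 : ℤ) : ℂ) - (γ 0 0 : ℤ) = N₀ * ((e : ℂ) + (γ 0 0 : ℤ) * e - (γ 0 1 : ℤ) * L * N₀ * c₁) := by
    exact_mod_cast ht
  have hden : ((γ' 1 0 : ℤ) : ℂ) * ((j : ℂ) / N₀ + z) + ((γ' 1 1 : ℤ) : ℂ) =
      ((γ 1 0 : ℤ) : ℂ) * (z : ℂ) + ((γ 1 1 : ℤ) : ℂ) := by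
    rw [h10, h11]; push_cast; rw [hcC]; field_simp; ring
  refine ⟨?_, by rw [hpt]; exact hden⟩
  apply UpperHalfPlane.ext
  rw [coe_vadd, coe_specialLinearGroup_apply, coe_specialLinearGroup_apply, hpt]
  simp only [eq_intCast]
  push_cast
  rw [hden, div_eq_iff hdenz, add_mul, div_mul_cancel₀ _ hdenz, h00, h01]
  push_cast
  field_simp
  linear_combination (-((j : ℂ) * (z : ℂ))) * hcC - (j : ℂ) * htC

/-- **(G2) INVARIANCE IS INHERITED BY TRANSLATE AVERAGES.** Let `F : ℍ → ℂ` be weight-`κ` invariant under every `γ′ ∈ SL₂(ℤ)` with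
`L ∣ γ′₁₀` and `L₁ ∣ γ′₁₁ − 1`, where `L₁ ∣ L`. Then for every `N₀ ≥ 1` and ANY weights `b : ℤ/N₀ → ℂ`, the translate average
`T(z) = Σ_{j mod N₀} b(j)·F(z + j/N₀)` satisfies `T ∣_κ γ = T` for every `γ ∈ SL₂(ℤ)` with `L N₀² ∣ γ₁₀`, `N₀ ∣ γ₁₁ − 1` and
`L₁ ∣ γ₁₁ − 1` (the group `Γ₀(L N₀²) ⊓ Γ₁(lcm(N₀, L₁))`). Mechanism: `τ(j/N₀)·γ = γ′_j·τ(j/N₀)` with `γ′_j ∈ SL₂(ℤ)`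
(`conj_translate_smul_eq`), `L ∣ (γ′_j)₁₀ = γ₁₀`, `(γ′_j)₁₁ ≡ γ₁₁ (mod L₁)`. Shimura's proof of Prop. 3.64 for a general weight vector
(the character case needs `b(d²j) ∼ b(j)`; on `Γ₁(N₀)`-type `d` this is vacuous). [cite: Shimura1971, Prop. 3.64] [cite: DiamondShurman2005, §1.2] -/
theorem translateAverage_slash_eq {L L₁ N₀ : ℕ} [NeZero N₀] (hL₁ : L₁ ∣ L) {κ : ℤ} (F : ℍ → ℂ)
    (hF : ∀ γ : SL(2, ℤ), (L : ℤ) ∣ γ 1 0 → (L₁ : ℤ) ∣ γ 1 1 - 1 → F ∣[κ] γ = F)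
    (b : ZMod N₀ → ℂ) (γ : SL(2, ℤ)) (hc : (L : ℤ) * (N₀ : ℤ) ^ 2 ∣ γ 1 0) (hd₀ : (N₀ : ℤ) ∣ γ 1 1 - 1)
    (hd₁ : (L₁ : ℤ) ∣ γ 1 1 - 1) :
    (fun z : ℍ ↦ ∑ j : ZMod N₀, b j * F (((j.val : ℝ) / N₀) +ᵥ z)) ∣[κ] γ =
      fun z : ℍ ↦ ∑ j : ZMod N₀, b j * F (((j.val : ℝ) / N₀) +ᵥ z) := by
  have hN₀ : (N₀ : ℤ) ≠ 0 := by exact_mod_cast NeZero.ne N₀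
  obtain ⟨c₁, hc₁⟩ := hc
  obtain ⟨e, he⟩ := hd₀
  funext z
  rw [ModularForm.slash_action_eq'_iff, Finset.mul_sum]
  refine Finset.sum_congr rfl fun j _ ↦ ?_
  -- the conjugated matrix `γ′_j`
  have hc' : γ 1 0 = (L : ℤ) * (N₀ : ℤ) ^ 2 * c₁ := by rw [hc₁]
  have hdet : γ 0 0 * γ 1 1 - γ 0 1 * γ 1 0 = 1 := by
    have := Matrix.det_fin_two (γ : Matrix (Fin 2) (Fin 2) ℤ)
    rw [Matrix.SpecialLinearGroup.det_coe] at this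
    linear_combination -this
  have ht : (γ 1 1 : ℤ) - γ 0 0 = N₀ * (e + γ 0 0 * e - γ 0 1 * L * N₀ * c₁) := by
    rw [hc'] at hdet
    linear_combination (1 + γ 0 0) * he - hdet
  let A : Matrix (Fin 2) (Fin 2) ℤ :=
    !![γ 0 0 + (j.val : ℤ) * L * N₀ * c₁, γ 0 1 + (j.val : ℤ) * (e + γ 0 0 * e - γ 0 1 * L * N₀ * c₁) - (j.val : ℤ) ^ 2 * L * c₁;
      L * N₀ ^ 2 * c₁, γ 1 1 - (j.val : ℤ) * L * N₀ * c₁]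
  have hA : A.det = 1 := by
    rw [Matrix.det_fin_two_of]
    rw [hc'] at hdet
    linear_combination hdet + ((j.val : ℤ) * L * N₀ * c₁) * ht
  let γ' : SL(2, ℤ) := ⟨A, hA⟩
  obtain ⟨hsmul, hden⟩ := conj_translate_smul_eq γ γ' hN₀ (j.val : ℤ) hc' he rfl rfl rfl rfl z
  -- `F` is invariant under `γ′_j`
  have hγ' : F ∣[κ] γ' = F := by
    refine hF γ' ⟨(N₀ : ℤ) ^ 2 * c₁, ?_⟩ ?_
    · show (L : ℤ) * N₀ ^ 2 * c₁ = L * (N₀ ^ 2 * c₁); ring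
    · show (L₁ : ℤ) ∣ γ 1 1 - (j.val : ℤ) * L * N₀ * c₁ - 1
      obtain ⟨l, hl⟩ := hL₁
      have : γ 1 1 - (j.val : ℤ) * L * N₀ * c₁ - 1 = (γ 1 1 - 1) + (L₁ : ℤ) * (-((j.val : ℤ) * l * N₀ * c₁)) := by
        rw [hl]; push_cast; ring
      rw [this]
      exact dvd_add hd₁ (dvd_mul_right _ _)
  have hval := (ModularForm.slash_action_eq'_iff κ F γ' (((j.val : ℤ) : ℝ) / N₀ +ᵥ z)).mp (congrFun hγ' _)
  simp only [Int.cast_natCast] at hsmul hval hden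
  rw [← hsmul, hval, hden]
  ring

/-! ## §3 (G3) The vehicle of T5 in T3's `hinv` shape -/

/-- **(G3) THE VEHICLE'S `hinv`.** Let `q, Q₀ ≥ 1` and `F ∈ M_{2κ/2}(4(qQ₀)², 1)` (in T5: `F = H_k · θ((qQ₀)²·)`, `κ = k + 1`, by
Cohen 1975 Thm 3.1 = NF-A, w8 g7's `thetaMul_sq_mem_halfIntModularForms` and `mul_mem_halfIntModularForms`), and let
`T(z) = Σ_{j mod Q₀} b(j)·F(z + j/Q₀)` for ANY weights `b` (in T5: the away-from-`q` `τ`-cut, period `Q₀` with `q ∤ Q₀`). Then with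
`M := 4·Q₀⁴`: **`∀ γ ∈ SL₂(ℤ), M·q² ∣ γ₁₀ → M ∣ γ₁₁ − 1 → T ∣_κ γ = T`** — the hypothesis `hinv` of `slash_flippedCusp_decomposition` /
`coeff_flippedCusp_eq` for the vehicle `F₀ := T`. (`M q² = 4q²Q₀⁴ = 4(qQ₀)²·Q₀²`; `M ∣ d − 1` gives `Q₀ ∣ d − 1` and `4 ∣ d − 1`.)
[cite: Shimura1971, Prop. 3.64] [cite: Shimura1973HalfIntegral, §1] -/
theorem vehicle_slash_eq {q Q₀ : ℕ} [NeZero Q₀] (hq : q ≠ 0) {κ : ℕ} {F : ℍ → ℂ}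
    (hF : F ∈ halfIntModularForms (2 * κ) (4 * (q * Q₀) ^ 2) (1 : DirichletCharacter ℂ (4 * (q * Q₀) ^ 2)))
    (b : ZMod Q₀ → ℂ) (γ : SL(2, ℤ)) (hc : (4 * (Q₀ : ℤ) ^ 4) * (q : ℤ) ^ 2 ∣ γ 1 0)
    (hd : 4 * (Q₀ : ℤ) ^ 4 ∣ γ 1 1 - 1) :
    (fun z : ℍ ↦ ∑ j : ZMod Q₀, b j * F (((j.val : ℝ) / Q₀) +ᵥ z)) ∣[(κ : ℤ)] γ =
      fun z : ℍ ↦ ∑ j : ZMod Q₀, b j * F (((j.val : ℝ) / Q₀) +ᵥ z) := by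
  haveI : NeZero (4 * (q * Q₀) ^ 2) := ⟨Nat.mul_ne_zero (by norm_num) (pow_ne_zero 2 (Nat.mul_ne_zero hq (NeZero.ne Q₀)))⟩
  have hbase : ∀ γ' : SL(2, ℤ), ((4 * (q * Q₀) ^ 2 : ℕ) : ℤ) ∣ γ' 1 0 → ((4 : ℕ) : ℤ) ∣ γ' 1 1 - 1 →
      F ∣[(κ : ℤ)] γ' = F := fun γ' hc' hd' ↦
    slash_eq_of_mem_even_one (dvd_mul_right 4 _) hF γ' hc' (by exact_mod_cast hd')
  refine translateAverage_slash_eq (L := 4 * (q * Q₀) ^ 2) (L₁ := 4) (N₀ := Q₀) (dvd_mul_right 4 _) F hbase b γ ?_ ?_ ?_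
  · have : ((4 * (q * Q₀) ^ 2 : ℕ) : ℤ) * (Q₀ : ℤ) ^ 2 = (4 * (Q₀ : ℤ) ^ 4) * (q : ℤ) ^ 2 := by push_cast; ring
    rw [this]; exact hc
  · exact (Dvd.intro_left _ (by ring : 4 * (Q₀ : ℤ) ^ 3 * Q₀ = 4 * (Q₀ : ℤ) ^ 4)).trans hd
  · exact (Dvd.intro _ (by push_cast; ring : ((4 : ℕ) : ℤ) * (Q₀ : ℤ) ^ 4 = 4 * (Q₀ : ℤ) ^ 4)).trans hd

end Summit.BirchSwinnertonDyer.BirchSwinnertonDyer.Theorems.PrintCFram.FlipRung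

end
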